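import Summits.FinalStateConjecture.FinalStateConjecture.Theorems.UniformPhotonSphereChannels.Negative.EnergyDefectIdentity
import Summits.FinalStateConjecture.FinalStateConjecture.Theorems.PhotonSphereChannelsExteriorEnergy

/-!
# Crux `UniformPhotonSphereChannels` (K1), negative side — energy monotonicity on the NEAR cone
# for functions solving the equation only there (kernel elements)

Support file of the standing disprover of item stmt-FinalStateConjecture-10045 (kernel census).
An element `p` of the candidate kernel `P(ρ)` is `C²` and solves `p_tt − p_xx + V p = 0` only on
the open exterior cone; on its near (horizon-side) component `Ω = {x + |t| < e₀}` (`e₀ = x_c − ρ`)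
we prove the expected monotonicity of its energy on receding half-lines,

`∫⁻_{x < e₀ − ε − t} e[p](t,·) ≤ ∫⁻_{x < e₀ − ε} e[p](0,·)`   (`ε > 0`, `t ≥ 0`),

by multiplying `p` with a smooth cut-off `η(t,x) = g(e₀ − x − t) g(e₀ − x + t)` (equal to `1` on
`{x + |t| < e₀ − ε/2}`, supported in `Ω`), which yields a GLOBAL `C²` function whose defect
vanishes where `η = 1`, and applying the local domain-of-dependence inequality
`WaveDefect.energy_shrinking_le_of_defect` plus the half-line exhaustion of
`WaveEnergy.lintegral_Iio_le_of_forall`.  Curried `deriv`/`iteratedDeriv` vocabulary as in the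
route decls. [folklore]
-/

namespace Summit.FinalStateConjecture.FinalStateConjecture.Theorems

open MeasureTheory Set Filter Topology intervalIntegral

noncomputable section

namespace KernelCensus

open WaveEnergy WaveDefect

variable {V : ℝ → ℝ} {e₀ : ℝ} {p : ℝ → ℝ → ℝ}

/-- The one-dimensional cut-off profile: smooth, `= 0` on `(−∞, ε/4]`, `= 1` on `[ε/2, ∞)`. -/
theorem cutoff_profile {ε : ℝ} (hε : 0 < ε) :
    ∃ g : ℝ → ℝ, ContDiff ℝ 2 g ∧ (∀ s, s ≤ ε / 4 → g s = 0) ∧ (∀ s, ε / 2 ≤ s → g s = 1) := by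
  refine ⟨fun s => Real.smoothTransition ((s - ε / 4) / (ε / 4)), ?_, ?_, ?_⟩
  · exact (Real.smoothTransition.contDiff (n := 2)).comp
      (by fun_prop : ContDiff ℝ 2 (fun s : ℝ => (s - ε / 4) / (ε / 4)))
  · intro s hs
    apply Real.smoothTransition.zero_of_nonpos
    exact div_nonpos_of_nonpos_of_nonneg (by linarith) (by linarith)
  · intro s hs
    apply Real.smoothTransition.one_of_one_le
    rw [le_div_iff₀ (by linarith)]
    linarith

/-- **The cut-off extension.**  For `p` `C²` on the near cone `Ω = {x + |t| < e₀}` and `ε > 0`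
there is a global `C²` function `u` on `ℝ²` agreeing with `p` on the open set
`N = {x + |t| < e₀ − ε/2}`. -/
theorem exists_cutoff_extension (hp : ContDiffOn ℝ 2 (Function.uncurry p) {z : ℝ × ℝ | z.2 + |z.1| < e₀})
    {ε : ℝ} (hε : 0 < ε) :
    ∃ u : ℝ × ℝ → ℝ, ContDiff ℝ 2 u ∧
      ∀ z : ℝ × ℝ, z.2 + |z.1| < e₀ - ε / 2 → u =ᶠ[𝓝 z] Function.uncurry p := by
  obtain ⟨g, hg, hg0, hg1⟩ := cutoff_profile hε
  set η : ℝ × ℝ → ℝ := fun z => g (e₀ - (z.2 + z.1)) * g (e₀ - (z.2 - z.1)) with hη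
  have hηs : ContDiff ℝ 2 η := by
    simp only [hη]
    fun_prop
  set u : ℝ × ℝ → ℝ := fun z => η z * Function.uncurry p z with hu
  have hΩ : IsOpen {z : ℝ × ℝ | z.2 + |z.1| < e₀} := isOpen_lt (by fun_prop) continuous_const
  have hO : IsOpen {z : ℝ × ℝ | e₀ - ε / 4 < z.2 + |z.1|} := isOpen_lt continuous_const (by fun_prop)
  -- `η = 0` on `O`, `η = 1` on `N`
  have hη0 : ∀ z : ℝ × ℝ, e₀ - ε / 4 < z.2 + |z.1| → η z = 0 := by
    intro z hz
    simp only [hη]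
    rcases le_or_gt 0 z.1 with h | h
    · rw [abs_of_nonneg h] at hz
      rw [hg0 _ (by linarith), zero_mul]
    · rw [abs_of_neg h] at hz
      rw [hg0 (e₀ - (z.2 - z.1)) (by linarith), mul_zero]
  have hη1 : ∀ z : ℝ × ℝ, z.2 + |z.1| < e₀ - ε / 2 → η z = 1 := by
    intro z hz
    simp only [hη]
    have h1 : z.1 ≤ |z.1| := le_abs_self _
    have h2 : -z.1 ≤ |z.1| := neg_le_abs _
    rw [hg1 _ (by linarith), hg1 _ (by linarith), one_mul]
  refine ⟨u, ?_, ?_⟩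
  · rw [contDiff_iff_contDiffAt]
    intro z
    by_cases hz : z.2 + |z.1| < e₀
    · exact (hηs.contDiffAt).mul (hp.contDiffAt (hΩ.mem_nhds hz))
    · have hzO : e₀ - ε / 4 < z.2 + |z.1| := by linarith
      have hev : u =ᶠ[𝓝 z] fun _ => 0 := by
        filter_upwards [hO.mem_nhds hzO] with w hw
        simp only [hu, hη0 w hw, zero_mul]
      exact (contDiffAt_const.congr_of_eventuallyEq hev)
  · intro z hz
    have hN : IsOpen {w : ℝ × ℝ | w.2 + |w.1| < e₀ - ε / 2} := isOpen_lt (by fun_prop) continuous_const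
    filter_upwards [hN.mem_nhds hz] with w hw
    simp only [hu, hη1 w hw, one_mul]

/-- Slice bookkeeping: if `u = uncurry p` near every point of an open set containing `(t, x)`, the
`t`-slice and `x`-slice of `u` agree with those of `p` near `t` resp. `x`. -/
theorem slices_eventuallyEq {u : ℝ × ℝ → ℝ} {S : Set (ℝ × ℝ)} (hS : IsOpen S)
    (hu : ∀ z ∈ S, u =ᶠ[𝓝 z] Function.uncurry p) {t x : ℝ} (hz : (t, x) ∈ S) :
    ((fun τ => u (τ, x)) =ᶠ[𝓝 t] fun τ => p τ x) ∧ ((fun y => u (t, y)) =ᶠ[𝓝 x] fun y => p t y) := by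
  have heq : ∀ w ∈ S, u w = Function.uncurry p w := fun w hw => (hu w hw).self_of_nhds
  constructor
  · have h1 : ∀ᶠ τ in 𝓝 t, (τ, x) ∈ S :=
      (Continuous.prodMk_left x).continuousAt.preimage_mem_nhds (hS.mem_nhds hz)
    filter_upwards [h1] with τ hτ
    exact heq _ hτ
  · have h1 : ∀ᶠ y in 𝓝 x, (t, y) ∈ S :=
      (Continuous.prodMk_right t).continuousAt.preimage_mem_nhds (hS.mem_nhds hz)
    filter_upwards [h1] with y hy
    exact heq _ hy

/-- **Energy monotonicity on the near cone for local solutions.**  Let `V ∈ C¹`, `V ≥ 0`, and let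
`p` be `C²` on `Ω = {x + |t| < e₀}` with `p_tt − p_xx + V p = 0` there (curried `iteratedDeriv 2`
form).  Then for `ε > 0`, `t ≥ 0`:
`∫⁻_{x < e₀ − ε − t} e[p](t,·) ≤ ∫⁻_{x < e₀ − ε} e[p](0,·)`, `e[p] = p_t² + p_x² + V p²`. [folklore] -/
theorem nearCone_lintegral_shrinking_le (hV : ContDiff ℝ 1 V) (hV0 : ∀ x, 0 ≤ V x)
    (hp : ContDiffOn ℝ 2 (Function.uncurry p) {z : ℝ × ℝ | z.2 + |z.1| < e₀})
    (hsol : ∀ z : ℝ × ℝ, z.2 + |z.1| < e₀ →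
      iteratedDeriv 2 (fun τ => p τ z.2) z.1 - iteratedDeriv 2 (p z.1) z.2 + V z.2 * p z.1 z.2 = 0)
    {ε t : ℝ} (hε : 0 < ε) (ht : 0 ≤ t) :
    ∫⁻ x in Iio (e₀ - ε - t), ENNReal.ofReal
        (deriv (fun τ => p τ x) t ^ 2 + deriv (p t) x ^ 2 + V x * p t x ^ 2)
      ≤ ∫⁻ x in Iio (e₀ - ε), ENNReal.ofReal
        (deriv (fun τ => p τ x) 0 ^ 2 + deriv (p 0) x ^ 2 + V x * p 0 x ^ 2) := by
  obtain ⟨u, hu, huN⟩ := exists_cutoff_extension hp hε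
  have hN : IsOpen {w : ℝ × ℝ | w.2 + |w.1| < e₀ - ε / 2} := isOpen_lt (by fun_prop) continuous_const
  -- curried copy of `u` and the bridge to `deriv` / `iteratedDeriv`
  set uc : ℝ → ℝ → ℝ := fun τ y => u (τ, y) with huc
  have hucu : Function.uncurry uc = u := by funext z; rfl
  have huc2 : ContDiff ℝ 2 (Function.uncurry uc) := by rw [hucu]; exact hu
  have hslice : ∀ τ y : ℝ, y + |τ| < e₀ - ε / 2 →
      deriv (fun σ => p σ y) τ = fderiv ℝ u (τ, y) (1, 0) ∧
      deriv (p τ) y = fderiv ℝ u (τ, y) (0, 1) ∧ p τ y = u (τ, y) ∧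
      (fderiv ℝ (fderiv ℝ u) (τ, y) (1, 0) (1, 0) - fderiv ℝ (fderiv ℝ u) (τ, y) (0, 1) (0, 1)
        + V y * u (τ, y) = 0) := by
    intro τ y hy
    obtain ⟨h1, h2⟩ := slices_eventuallyEq (p := p) hN huN (t := τ) (x := y) hy
    have e1 := deriv_slice_fst_eq huc2 τ y
    have e2 := deriv_slice_snd_eq huc2 τ y
    have e3 := iteratedDeriv_two_slice_fst_eq huc2 τ y
    have e4 := iteratedDeriv_two_slice_snd_eq huc2 τ y
    rw [hucu] at e1 e2 e3 e4
    simp only [huc] at e1 e2 e3 e4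
    have hp0 : p τ y = u (τ, y) := by
      have := (huN (τ, y) hy).self_of_nhds
      simpa using this.symm
    refine ⟨by rw [← h1.deriv_eq, e1], by rw [← h2.deriv_eq]; exact e2, hp0, ?_⟩
    rw [← e3, ← e4, h1.iteratedDeriv_eq 2, h2.iteratedDeriv_eq 2, ← hp0]
    have hp2 : (fun y' => p τ y') = p τ := rfl
    rw [hp2]
    exact hsol (τ, y) (by linarith)
  -- the Fréchet energy density of `u` and the time-independent potential
  set W : ℝ × ℝ → ℝ := fun z => V z.2 with hW
  have hW1 : ContDiff ℝ 1 W := hV.comp contDiff_snd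
  have hW0 : ∀ z, 0 ≤ W z := fun z => hV0 z.2
  have hWt : ∀ z : ℝ × ℝ, fderiv ℝ W z (1, 0) = 0 := by
    intro z
    have hd : HasFDerivAt W ((fderiv ℝ V z.2).comp (ContinuousLinearMap.snd ℝ ℝ ℝ)) z :=
      ((hV.differentiable (by norm_num)) z.2).hasFDerivAt.comp z hasFDerivAt_snd
    rw [hd.fderiv]
    simp
  set e : ℝ × ℝ → ℝ := fun z => (fderiv ℝ u z (1, 0)) ^ 2 + (fderiv ℝ u z (0, 1)) ^ 2 + W z * u z ^ 2
    with hedef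
  have he : ∀ z, e z = (fderiv ℝ u z (1, 0)) ^ 2 + (fderiv ℝ u z (0, 1)) ^ 2 + W z * u z ^ 2 :=
    fun z => rfl
  have hec : Continuous e := (differentiable_energyDensity hu (hW1.differentiable (by norm_num)) he).continuous
  have he0 : ∀ z, 0 ≤ e z := energyDensity_nonneg hW0 he
  -- finite-interval inequality from the local domain of dependence
  have hfin : ∀ A : ℝ, A + t ≤ e₀ - ε - t →
      (∫ x in (A + t)..(e₀ - ε - t), e (t, x)) ≤ ∫ x in A..(e₀ - ε), e (0, x) := by
    intro A hA
    have key := energy_shrinking_le_of_defect hu hW1 hW0 he A (e₀ - ε) ht (fun s hs x hx => ?_)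
      (fun s _ x _ => hWt (s, x))
    · simpa only [sub_zero] using key
    · simp only [sub_zero] at hx
      have hs2 : A + s ≤ e₀ - ε - s := by linarith [hs.1, hs.2]
      rw [uIcc_of_le hs2] at hx
      have hxs : x + |s| < e₀ - ε / 2 := by
        rw [abs_of_nonneg hs.1]
        linarith [hx.2]
      exact (hslice s x hxs).2.2.2
  -- half-line exhaustion
  have hhalf : ∫⁻ x in Iio (e₀ - ε - t), ENNReal.ofReal (e (t, x))
      ≤ ∫⁻ x in Iio (e₀ - ε), ENNReal.ofReal (e (0, x)) := by
    refine lintegral_Iio_le_of_forall (hec.comp (Continuous.prodMk_right t))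
      (hec.comp (Continuous.prodMk_right 0)) (fun x => he0 _) (fun x => he0 _) fun n => ?_
    refine ⟨e₀ - ε - t - n - t, by linarith, ?_⟩
    have key := hfin (e₀ - ε - t - n - t) (by linarith)
    have e1 : e₀ - ε - t - ↑n - t + t = e₀ - ε - t - n := by ring
    rw [e1] at key
    exact key
  -- back to `p`
  have hL : ∫⁻ x in Iio (e₀ - ε - t), ENNReal.ofReal
        (deriv (fun τ => p τ x) t ^ 2 + deriv (p t) x ^ 2 + V x * p t x ^ 2)
      = ∫⁻ x in Iio (e₀ - ε - t), ENNReal.ofReal (e (t, x)) := by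
    refine setLIntegral_congr_fun measurableSet_Iio (fun x hx => ?_)
    have hx' : x + |t| < e₀ - ε / 2 := by
      rw [abs_of_nonneg ht]; simp only [mem_Iio] at hx; linarith
    obtain ⟨h1, h2, h3, -⟩ := hslice t x hx'
    simp only [he, hW, h1, h2, h3]
  have hR : ∫⁻ x in Iio (e₀ - ε), ENNReal.ofReal
        (deriv (fun τ => p τ x) 0 ^ 2 + deriv (p 0) x ^ 2 + V x * p 0 x ^ 2)
      = ∫⁻ x in Iio (e₀ - ε), ENNReal.ofReal (e (0, x)) := by
    refine setLIntegral_congr_fun measurableSet_Iio (fun x hx => ?_)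
    have hx' : x + |(0 : ℝ)| < e₀ - ε / 2 := by
      simp only [abs_zero, add_zero]; simp only [mem_Iio] at hx; linarith
    obtain ⟨h1, h2, h3, -⟩ := hslice 0 x hx'
    simp only [he, hW, h1, h2, h3]
  rw [hL, hR]
  exact hhalf

end KernelCensus

end

end Summit.FinalStateConjecture.FinalStateConjecture.Theorems
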